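import Summits.QuantumFields.YangMills.Theorems.BalabanUVNodesN07Prop8StepFlatWitness
import Literature.MathematicalPhysics.QuantumFieldTheory.Balaban1983to89.Node00.CriticalOnFibreTopGuarded

/-!
# BalabanUVNodes ∕ N07 ([Balaban1985Variational] Prop. 8 p. 304, p. 304 lines 1–2) — NON-VACUITY OF THE GUARDED STUB-1 TEXT: the binder block of `Node00.Prop8RegSepTopStepG … Adm …`
# (module 47) IS INHABITED at the flat datum on dag-n21-c's separated top index, for EVERY guard that passes the chosen prefix — in particular for the plan's V20-G guard
# `fun ν _ _ K k _ => c ≤ ν.M₁ ∧ k + c₀ ≤ F.m + K` at EVERY `(c, c₀)` and EVERY family (module 32's G-edition)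

Cell `pub-ymgap` (HUMAN RULINGS D-0062 ∕ D-0088), seat `pub-ymgap-dag-n07-e` generation 21 (R141 (C) row s3 lineage; DAG node N07 = [B11]; lane owner).
`--kind proof --supports stmt-QuantumFields-20541 --as helper` (K0⁷; count-neutral).  THEOREMS ONLY (0 `def`, 0 `sorry`).  Companion of module 32 (p554061, V19's witness) for the
plan's WORD V20 = G (cell bus 2026-08-28 11:44Z): the re-texted stub 1 `Prop8StepCoPGAt F := ∃ (c c₀ : ℕ) (B₃ a₀ a₁ : ℝ), 2·L² ≤ B₃ ∧ 0 < a₀ ∧ 0 < a₁ ∧ Prop8RegSepTopStepG F 2 suppDom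
(fun ν _M _g K k _s => c ≤ ν.M₁ ∧ k + c₀ ≤ F.m + K) B₃ a₀ a₁` quantifies a guarded implication; referee NOTE-1 (ref-G) asks that such a text be NON-VACUOUS — its hypotheses jointly
satisfiable under the guard.  THIS FILE: (i) for ANY guard `Adm` holding at the prefix `(ν, M, g, K, k)` for every index `s`, module 32's flat inhabitant of the whole binder block
(`prop8RegSepTopStep_binders_inhabited_flat`) passes the guard too; (ii) the V20-G guard at given `(c, c₀)` is met by the prefix whenever `c ≤ ν.M₁` and `k + c₀ ≤ F.m + K`; (iii) for
EVERY family `F` and EVERY `(c, c₀)` such a prefix EXISTS (`ν.M₁ := c + 1`, `M := 1`, `K := c₀ + 1`, `k := 1`), so the G text's binder block is inhabited outright — the guarded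
stub is an inhabited-implication question exactly as V19's was (A2 non-vacuity BY NAME).
HONEST FRAMING: count-neutral kernel bookkeeping at the FLAT datum (`U ≡ 1`, `𝐖 ≡ 1`); Prop. 8 NOT claimed in any reading; nothing of Bałaban asserted; `stub_prop8StepCoP13` ∕ K0⁷ NOT
closed; N07 NOT discharged (5∕27); counts unmoved (28∕28); one finite 𝕋⁴ programme at fixed ε — R4 closes the conditional finite-𝕋⁴ rung `BalabanLadder.UV` only; NOT continuum ∕ ℝ⁴ ∕
OS ∕ mass gap ∕ Clay.

DEPENDENCES (by name): module 32 `…N07Prop8StepFlatWitness.prop8RegSepTopStep_binders_inhabited_flat` (dag-n21-c's `exists_seq_top` inside), module 47 `Node00.StepGuard`, `floorGuard`.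
[B11] = [Balaban1985Variational] Prop. 8 p.304, p.304 lines 1–2 («We may assume that R₁M₁ is sufficiently big»); [6] = [Balaban1985RegularSpaces] (1.3)–(1.6) p.77; [I] = [Balaban1987RG1]
(0.1) p.251 (the torus `L^{m+K}`, `m ≥ 1`).
-/

noncomputable section

namespace Summit.QuantumFields.YangMills.BalabanUVNodes.N07Prop8StepFlatWitness

open Literature.MathematicalPhysics.QuantumFieldTheory.Balaban1983to89
open Literature.MathematicalPhysics.QuantumFieldTheory.Balaban1983to89.T4Continuum (T4Family)
open Literature.MathematicalPhysics.QuantumFieldTheory.Balaban1983to89.B15DeterminingSets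
open Literature.MathematicalPhysics.QuantumFieldTheory.Balaban1983to89.Node00
open scoped Matrix.Norms.L2Operator

section WitnessG

variable (F : T4Family) (N : ℕ) [NeZero N]

/-- ★ **THE BINDER BLOCK OF THE GUARDED STUB-1 FACT `Prop8RegSepTopStepG … Adm …` IS INHABITED at the flat datum on the separated top index, for every guard `Adm` that holds at the
prefix `(ν, M, g, K, k)` for every index `s`** — module 32's `prop8RegSepTopStep_binders_inhabited_flat` with the guard conjunct added (the inhabitant is module 32's; the guard is read
off `hadm`).  With its conclusion holding there too. [cite: Balaban1985Variational, Prop. 8 p.304, p.304 lines 1–2; Balaban1987RG1, (0.1) p.251 (bookkeeping)] -/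
theorem prop8RegSepTopStepG_binders_inhabited_flat
    (Sup : (ν : Stage7Numerics) → (K : ℕ) → (ℕ → Set (Site (F.P K) 0)) → Set (Site (F.P K) 0)) (Adm : StepGuard F) {B₃ a₀ a₁ : ℝ} (hB₃ : 0 < B₃)
    (ha₀ : 0 < a₀) (ha₁ : 0 < a₁) (ν : Stage7Numerics) (hM₁ : 0 < ν.M₁) {M : ℕ} (hM : 1 ≤ M) (g : ℕ → ℝ) (K k : ℕ) (hk : 1 ≤ k)
    (hadm : ∀ s : SeqOfRecord F ν M g K k, Adm ν M g K k s) :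
    ∃ (s : SeqOfRecord F ν M g K k) (ε₀ : ℝ) (δ : ℕ → ℝ) (W : MSField (F.P K) (SU N)) (U : GaugeField (F.P K) 0 (SU N)),
      Sect2.SeqSeparated ν.M₁ s ∧ 0 < ν.M₁ ∧ Adm ν M g K k s ∧ 1 ≤ k ∧
      (∀ n, n ≤ k → 0 < δ n ∧ δ n ≤ a₁ ∧ B₃ * δ n ≤ ε₀) ∧ (∀ n, n < k → δ n ≤ 2 * δ (n + 1)) ∧ (∀ n, n < k → δ (n + 1) ≤ 2 * δ n) ∧
      ε₀ ≤ a₀ ∧ Sect2.DataSmall7PTop (avOfRecord F N K) s.Ω (Sup ν K s.Ω) k δ W ∧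
      (∀ n, n ≤ k → PlaqSmallOn (Sect2.omegaPlaqsTop s.Ω (Sup ν K s.Ω) n) (ε₀ * (F.P K).eta n ^ 2) U) ∧
      Sect2.CoDivClassOnTop s.Ω (Sup ν K s.Ω) k ε₀ U ∧ AgreeOn (genSet s.Ω k) (avgFamily (avOfRecord F N K) U) W ∧
      IsCritOnFibre F N K (genSet s.Ω k) W U ∧
      ((∀ n, n ≤ k → PlaqSmallOn (Sect2.omegaPlaqsTop s.Ω (Sup ν K s.Ω) n) (B₃ * δ n * (F.P K).eta n ^ 2) U) ∧
        ∀ n, n ≤ k → Sect2.CoDivSmallOn (Sect2.omegaBondsTop s.Ω (Sup ν K s.Ω) n) (B₃ * δ n * (F.P K).eta n ^ 3) U) := by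
  obtain ⟨s, ε₀, δ, W, U, hsep, hM₁', hk', hδ, hc, hc', hε₀, h7, h17, h19, hfib, hcrit, hconcl⟩ :=
    prop8RegSepTopStep_binders_inhabited_flat F N Sup hB₃ ha₀ ha₁ ν hM₁ hM g K k hk
  exact ⟨s, ε₀, δ, W, U, hsep, hM₁', hadm s, hk', hδ, hc, hc', hε₀, h7, h17, h19, hfib, hcrit, hconcl⟩

/-- ★ **THE PLAN's V20-G GUARD**: at any prefix with `c ≤ ν.M₁` (print p.304 lines 1–2) and `k + c₀ ≤ F.m + K` (the top level at least `c₀` below the torus exponent `m + K`,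
[I] (0.1)) the binder block of `Prop8RegSepTopStepG F N Sup (fun ν _ _ K k _ => c ≤ ν.M₁ ∧ k + c₀ ≤ F.m + K)` is inhabited at the flat datum, with its conclusion.
[cite: Balaban1985Variational, Prop. 8 p.304, p.304 lines 1–2; Balaban1985RegularSpaces, (1.3)–(1.6) p.77; Balaban1987RG1, (0.1) p.251 (bookkeeping)] -/
theorem prop8RegSepTopStepG_levelFloorGuard_binders_inhabited_flat
    (Sup : (ν : Stage7Numerics) → (K : ℕ) → (ℕ → Set (Site (F.P K) 0)) → Set (Site (F.P K) 0)) (c c₀ : ℕ) {B₃ a₀ a₁ : ℝ} (hB₃ : 0 < B₃)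
    (ha₀ : 0 < a₀) (ha₁ : 0 < a₁) (ν : Stage7Numerics) (hc : c ≤ ν.M₁) (hM₁ : 0 < ν.M₁) {M : ℕ} (hM : 1 ≤ M) (g : ℕ → ℝ) (K k : ℕ) (hk : 1 ≤ k)
    (hK : k + c₀ ≤ F.m + K) :
    ∃ (s : SeqOfRecord F ν M g K k) (ε₀ : ℝ) (δ : ℕ → ℝ) (W : MSField (F.P K) (SU N)) (U : GaugeField (F.P K) 0 (SU N)),
      Sect2.SeqSeparated ν.M₁ s ∧ 0 < ν.M₁ ∧ (c ≤ ν.M₁ ∧ k + c₀ ≤ F.m + K) ∧ 1 ≤ k ∧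
      (∀ n, n ≤ k → 0 < δ n ∧ δ n ≤ a₁ ∧ B₃ * δ n ≤ ε₀) ∧ (∀ n, n < k → δ n ≤ 2 * δ (n + 1)) ∧ (∀ n, n < k → δ (n + 1) ≤ 2 * δ n) ∧
      ε₀ ≤ a₀ ∧ Sect2.DataSmall7PTop (avOfRecord F N K) s.Ω (Sup ν K s.Ω) k δ W ∧
      (∀ n, n ≤ k → PlaqSmallOn (Sect2.omegaPlaqsTop s.Ω (Sup ν K s.Ω) n) (ε₀ * (F.P K).eta n ^ 2) U) ∧
      Sect2.CoDivClassOnTop s.Ω (Sup ν K s.Ω) k ε₀ U ∧ AgreeOn (genSet s.Ω k) (avgFamily (avOfRecord F N K) U) W ∧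
      IsCritOnFibre F N K (genSet s.Ω k) W U ∧
      ((∀ n, n ≤ k → PlaqSmallOn (Sect2.omegaPlaqsTop s.Ω (Sup ν K s.Ω) n) (B₃ * δ n * (F.P K).eta n ^ 2) U) ∧
        ∀ n, n ≤ k → Sect2.CoDivSmallOn (Sect2.omegaBondsTop s.Ω (Sup ν K s.Ω) n) (B₃ * δ n * (F.P K).eta n ^ 3) U) :=
  prop8RegSepTopStepG_binders_inhabited_flat F N Sup (fun ν _ _ K k _ => c ≤ ν.M₁ ∧ k + c₀ ≤ F.m + K) hB₃ ha₀ ha₁ ν hM₁ hM g K k hk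
    fun _ => ⟨hc, hK⟩

/-- ★★ **THE V20-G STUB-1 TEXT IS AN INHABITED-IMPLICATION QUESTION FOR EVERY FAMILY AND EVERY `(c, c₀)`**: there is a prefix passing the guard — numerics with `M₁ := c + 1` (every
other numeric as in any given `ν₀`), cube letter `M := 1`, `K := c₀ + 1`, top level `k := 1` (so `k + c₀ = K ≤ F.m + K`) — at which the whole binder block of
`Prop8RegSepTopStepG F N Sup (fun ν _ _ K k _ => c ≤ ν.M₁ ∧ k + c₀ ≤ F.m + K) B₃ a₀ a₁` is inhabited (flat datum, separated top index), with its conclusion.  A2 non-vacuity of the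
re-texted stub BY NAME. [cite: Balaban1985Variational, Prop. 8 p.304, p.304 lines 1–2; Balaban1987RG1, (0.1) p.251 (bookkeeping)] -/
theorem prop8RegSepTopStepG_levelFloorGuard_inhabited_flat
    (Sup : (ν : Stage7Numerics) → (K : ℕ) → (ℕ → Set (Site (F.P K) 0)) → Set (Site (F.P K) 0)) (c c₀ : ℕ) {B₃ a₀ a₁ : ℝ} (hB₃ : 0 < B₃)
    (ha₀ : 0 < a₀) (ha₁ : 0 < a₁) (ν₀ : Stage7Numerics) (g : ℕ → ℝ) :
    ∃ (ν : Stage7Numerics) (M K k : ℕ) (s : SeqOfRecord F ν M g K k) (ε₀ : ℝ) (δ : ℕ → ℝ) (W : MSField (F.P K) (SU N)) (U : GaugeField (F.P K) 0 (SU N)),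
      Sect2.SeqSeparated ν.M₁ s ∧ 0 < ν.M₁ ∧ (c ≤ ν.M₁ ∧ k + c₀ ≤ F.m + K) ∧ 1 ≤ k ∧
      (∀ n, n ≤ k → 0 < δ n ∧ δ n ≤ a₁ ∧ B₃ * δ n ≤ ε₀) ∧ (∀ n, n < k → δ n ≤ 2 * δ (n + 1)) ∧ (∀ n, n < k → δ (n + 1) ≤ 2 * δ n) ∧
      ε₀ ≤ a₀ ∧ Sect2.DataSmall7PTop (avOfRecord F N K) s.Ω (Sup ν K s.Ω) k δ W ∧
      (∀ n, n ≤ k → PlaqSmallOn (Sect2.omegaPlaqsTop s.Ω (Sup ν K s.Ω) n) (ε₀ * (F.P K).eta n ^ 2) U) ∧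
      Sect2.CoDivClassOnTop s.Ω (Sup ν K s.Ω) k ε₀ U ∧ AgreeOn (genSet s.Ω k) (avgFamily (avOfRecord F N K) U) W ∧
      IsCritOnFibre F N K (genSet s.Ω k) W U ∧
      ((∀ n, n ≤ k → PlaqSmallOn (Sect2.omegaPlaqsTop s.Ω (Sup ν K s.Ω) n) (B₃ * δ n * (F.P K).eta n ^ 2) U) ∧
        ∀ n, n ≤ k → Sect2.CoDivSmallOn (Sect2.omegaBondsTop s.Ω (Sup ν K s.Ω) n) (B₃ * δ n * (F.P K).eta n ^ 3) U) := by
  have hK : 1 + c₀ ≤ F.m + (c₀ + 1) := by have := F.hm; omega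
  obtain ⟨s, ε₀, δ, W, U, h⟩ := prop8RegSepTopStepG_levelFloorGuard_binders_inhabited_flat F N Sup c c₀ hB₃ ha₀ ha₁ { ν₀ with M₁ := c + 1 }
    (Nat.le_succ c) (Nat.succ_pos c) (M := 1) le_rfl g (c₀ + 1) 1 le_rfl hK
  exact ⟨{ ν₀ with M₁ := c + 1 }, 1, c₀ + 1, 1, s, ε₀, δ, W, U, h⟩

variable {F N}

/-- SANITY (the floor instance): with `Adm := floorGuard F c` the guarded block is the floor-carrying one of module 46 (`prop8RegSepTopStepR_iff_G_floorGuard`), inhabited at any prefix with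
`c ≤ ν.M₁`. [cite: Balaban1985Variational, p.304 lines 1–2; Balaban1985RegularSpaces, (1.3)–(1.6) p.77 (bookkeeping)] -/
theorem prop8RegSepTopStepG_floorGuard_binders_inhabited_flat
    (Sup : (ν : Stage7Numerics) → (K : ℕ) → (ℕ → Set (Site (F.P K) 0)) → Set (Site (F.P K) 0)) (c : ℕ) {B₃ a₀ a₁ : ℝ} (hB₃ : 0 < B₃)
    (ha₀ : 0 < a₀) (ha₁ : 0 < a₁) (ν : Stage7Numerics) (hc : c ≤ ν.M₁) (hM₁ : 0 < ν.M₁) {M : ℕ} (hM : 1 ≤ M) (g : ℕ → ℝ) (K k : ℕ) (hk : 1 ≤ k) :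
    ∃ (s : SeqOfRecord F ν M g K k) (ε₀ : ℝ) (δ : ℕ → ℝ) (W : MSField (F.P K) (SU N)) (U : GaugeField (F.P K) 0 (SU N)),
      Sect2.SeqSeparated ν.M₁ s ∧ 0 < ν.M₁ ∧ floorGuard F c ν M g K k s ∧ 1 ≤ k ∧
      (∀ n, n ≤ k → 0 < δ n ∧ δ n ≤ a₁ ∧ B₃ * δ n ≤ ε₀) ∧ (∀ n, n < k → δ n ≤ 2 * δ (n + 1)) ∧ (∀ n, n < k → δ (n + 1) ≤ 2 * δ n) ∧
      ε₀ ≤ a₀ ∧ Sect2.DataSmall7PTop (avOfRecord F N K) s.Ω (Sup ν K s.Ω) k δ W ∧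
      (∀ n, n ≤ k → PlaqSmallOn (Sect2.omegaPlaqsTop s.Ω (Sup ν K s.Ω) n) (ε₀ * (F.P K).eta n ^ 2) U) ∧
      Sect2.CoDivClassOnTop s.Ω (Sup ν K s.Ω) k ε₀ U ∧ AgreeOn (genSet s.Ω k) (avgFamily (avOfRecord F N K) U) W ∧
      IsCritOnFibre F N K (genSet s.Ω k) W U ∧
      ((∀ n, n ≤ k → PlaqSmallOn (Sect2.omegaPlaqsTop s.Ω (Sup ν K s.Ω) n) (B₃ * δ n * (F.P K).eta n ^ 2) U) ∧
        ∀ n, n ≤ k → Sect2.CoDivSmallOn (Sect2.omegaBondsTop s.Ω (Sup ν K s.Ω) n) (B₃ * δ n * (F.P K).eta n ^ 3) U) :=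
  prop8RegSepTopStepG_binders_inhabited_flat F N Sup (floorGuard F c) hB₃ ha₀ ha₁ ν hM₁ hM g K k hk fun _ => hc

end WitnessG

end Summit.QuantumFields.YangMills.BalabanUVNodes.N07Prop8StepFlatWitness

end
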